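import Literature.NumberTheory.Automorphic.ArchBigCellChartSmooth
import Literature.NumberTheory.Automorphic.ArchTestFunctionSpace
import HarnessLib

/-!
# Transport of test functions to the big Bruhat cell of `GL_n(K_∞)`

Topic `NumberTheory/Automorphic`; namespace `Literature.NumberTheory.Automorphic`. For the chart
`Ψ : 𝔫 × (K_∞ˣ)ⁿ × 𝔫 ≅ Ω = N w⁰ A N ⊂ GL_n(K_∞)` of `ArchBigCellChartSmooth` (`cellChartHomeo`,
`bruhatBigCell`), the **push-forward extended by zero**

  `cellPush h (g) = h(Ψ⁻¹ g)` for `g ∈ Ω`, `0` otherwise,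

of a smooth compactly supported `h` on `𝔫 × K_∞ⁿ × 𝔫` with `tsupport h ⊆ cellSource` is a test function
on `GL_n(K_∞)` (`isArchTestFunction_cellPush`: continuity and smoothness of the exponential slices
`M ↦ cellPush h (g exp M)` are local — `h ∘ Ψ⁻¹` near points of the compact `Ψ(tsupport h) ⊂ Ω`, zero near
the other points; compact support because `GL_n(K_∞) ↪ M_n(K_∞)` is an open embedding), and the left and
right translations by `N` correspond to the affine maps `X₁ ↦ u (1 + X₁) - 1`, `X₂ ↦ (1 + X₂) u - 1` of the
unipotent coordinates (`leftTranslate_cellPush`, `rightTranslate_cellPush`), which for the root elements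
`u = 1 + t E` with `E 𝔫 = 0`, resp. `𝔫 E = 0`, are the translations by `-t (E, 0, 0)`, resp. `t (0, 0, E)`,
of the parameter space (`leftTranslate_cellPush_rootElement`, `rightTranslate_cellPush_rootElement`).

Everything is proved; no named fact is introduced.

## References

* J. A. Shalika, *The multiplicity one theorem for `GL_n`*, Ann. of Math. 100 (1974), §2 [Shalika1974].
-/

noncomputable section

open MeasureTheory Measure NumberField NumberField.mixedEmbedding IsDedekindDomain Set Filter Matrix
open scoped MatrixGroups Topology Classical ContDiff Matrix.Norms.Operator

namespace Literature.NumberTheory.Automorphic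

variable {n : ℕ} {K : Type} [Field K] [NumberField K]

-- as in `ArchGardingWhittaker`: the scoped `L∞`-operator normed ring structure on matrices is only
-- reducibly defeq to the Pi uniformity
set_option backward.isDefEq.respectTransparency false

local notation "R∞" => mixedSpace K
local notation "Mat" => Matrix (Fin n) (Fin n) (mixedSpace K)
local notation "G∞" => GL (Fin n) (mixedSpace K)
local notation "E∞" => CellParam n (mixedSpace K)

/-! ### 1. The push-forward extended by zero -/

/-- **Push-forward along the chart, extended by zero**: `cellPush h (g) = h(Ψ⁻¹ g)` on the big cell and `0`
off it. [folklore] -/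
def cellPush (h : E∞ → ℂ) (g : G∞) : ℂ :=
  if (g : Mat) ∈ bruhatBigCell n R∞ then h ((cellChartHomeo n R∞).symm (g : Mat)) else 0

/-- On the big cell, `cellPush h = h ∘ Ψ⁻¹`. [folklore] -/
theorem cellPush_apply_of_mem {h : E∞ → ℂ} {g : G∞} (hg : (g : Mat) ∈ bruhatBigCell n R∞) :
    cellPush h g = h ((cellChartHomeo n R∞).symm (g : Mat)) := if_pos hg

/-- Off the big cell, `cellPush h = 0`. [folklore] -/
theorem cellPush_apply_of_not_mem {h : E∞ → ℂ} {g : G∞} (hg : (g : Mat) ∉ bruhatBigCell n R∞) : cellPush h g = 0 :=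
  if_neg hg

/-- `cellPush` is additive. [folklore] -/
theorem cellPush_add (h₁ h₂ : E∞ → ℂ) : cellPush (n := n) (K := K) (h₁ + h₂) = cellPush h₁ + cellPush h₂ := by
  funext g; by_cases hg : (g : Mat) ∈ bruhatBigCell n R∞ <;> simp [cellPush, hg]

/-- `cellPush` is homogeneous. [folklore] -/
theorem cellPush_smul (c : ℂ) (h : E∞ → ℂ) : cellPush (n := n) (K := K) (c • h) = c • cellPush h := by
  funext g; by_cases hg : (g : Mat) ∈ bruhatBigCell n R∞ <;> simp [cellPush, hg]

/-- The chart value at a point of `cellSource` as an element of `GL_n(K_∞)`. [folklore] -/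
def cellChartGL (e : E∞) (he : e ∈ cellSource n R∞) : G∞ :=
  unitri (e.1 : Mat) e.1.2 * weylLong n R∞ * diagUnitsGL e.2.1 he * unitri (e.2.2 : Mat) e.2.2.2

/-- The matrix of `cellChartGL e` is `Ψ e`. [folklore] -/
@[simp] theorem coe_cellChartGL (e : E∞) (he : e ∈ cellSource n R∞) : ((cellChartGL e he : G∞) : Mat) = cellChart e :=
  (bigCellMap_eq_coe e.1.2 e.2.2.2 he).symm

/-- The big cell consists of invertible matrices. [folklore] -/
theorem bruhatBigCell_subset_range : bruhatBigCell n R∞ ⊆ Set.range ((↑) : G∞ → Mat) := by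
  rintro _ ⟨e, he, rfl⟩
  exact ⟨cellChartGL e he, coe_cellChartGL e he⟩

/-- `cellPush h` at a chart point: `cellPush h (Ψ e) = h e`. [folklore] -/
theorem cellPush_cellChartGL (h : E∞ → ℂ) (e : E∞) (he : e ∈ cellSource n R∞) : cellPush h (cellChartGL e he) = h e := by
  rw [cellPush_apply_of_mem (by rw [coe_cellChartGL]; exact (cellChartHomeo n R∞).map_source he), coe_cellChartGL,
    ← cellChartHomeo_apply, (cellChartHomeo n R∞).left_inv he]

/-! ### 2. `cellPush h` is a test function -/

section TestFunction

/-- The image `Ψ(tsupport h)` is a compact subset of the big cell. [folklore] -/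
theorem isCompact_image_tsupport {h : E∞ → ℂ} (hh : HasCompactSupport h) : IsCompact (cellChart '' tsupport h : Set Mat) :=
  hh.isCompact.image contDiff_cellChart.continuous

/-- `Ψ(tsupport h) ⊆ Ω` when `tsupport h ⊆ cellSource`. [folklore] -/
theorem image_tsupport_subset {h : E∞ → ℂ} (hW : tsupport h ⊆ cellSource n R∞) : (cellChart '' tsupport h : Set Mat) ⊆ bruhatBigCell n R∞ :=
  fun _ ⟨_, he, hge⟩ => hge ▸ (cellChartHomeo n R∞).map_source (hW he)

/-- `cellPush h` vanishes at every `g` with `g ∉ Ψ(tsupport h)`. [folklore] -/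
theorem cellPush_eq_zero_of_not_mem_image {h : E∞ → ℂ} {g : G∞}
    (hg : (g : Mat) ∉ cellChart '' tsupport h) : cellPush h g = 0 := by
  by_cases hmem : (g : Mat) ∈ bruhatBigCell n R∞
  · rw [cellPush_apply_of_mem hmem]
    refine image_eq_zero_of_notMem_tsupport fun hsupp => hg ?_
    refine ⟨_, hsupp, ?_⟩
    rw [← cellChartHomeo_apply, (cellChartHomeo n R∞).right_inv hmem]
  · exact cellPush_apply_of_not_mem hmem

/-- Near a point of the big cell, `cellPush h` is `h ∘ Ψ⁻¹ ∘ val`. [folklore] -/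
theorem cellPush_eventuallyEq_of_mem {h : E∞ → ℂ} {g₀ : G∞} (hg₀ : (g₀ : Mat) ∈ bruhatBigCell n R∞) :
    cellPush h =ᶠ[𝓝 g₀] fun g : G∞ => h ((cellChartHomeo n R∞).symm (g : Mat)) := by
  have hopen : IsOpen {g : G∞ | (g : Mat) ∈ bruhatBigCell n R∞} := isOpen_bruhatBigCell.preimage Units.continuous_val
  filter_upwards [hopen.mem_nhds hg₀] with g hg
  exact cellPush_apply_of_mem hg

/-- Near a point off `Ψ(tsupport h)`, `cellPush h` vanishes. [folklore] -/
theorem cellPush_eventuallyEq_zero {h : E∞ → ℂ} (hh : HasCompactSupport h) {g₀ : G∞}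
    (hg₀ : (g₀ : Mat) ∉ cellChart '' tsupport h) : cellPush h =ᶠ[𝓝 g₀] fun _ => 0 := by
  have hopen : IsOpen {g : G∞ | (g : Mat) ∉ cellChart '' tsupport h} :=
    (isCompact_image_tsupport hh).isClosed.isOpen_compl.preimage Units.continuous_val
  filter_upwards [hopen.mem_nhds hg₀] with g hg
  exact cellPush_eq_zero_of_not_mem_image hg

/-- **`cellPush h` is continuous.** [folklore] -/
theorem continuous_cellPush {h : E∞ → ℂ} (hc : Continuous h) (hh : HasCompactSupport h) (hW : tsupport h ⊆ cellSource n R∞) :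
    Continuous (cellPush (n := n) (K := K) h) := by
  refine continuous_iff_continuousAt.2 fun g₀ => ?_
  by_cases hg₀ : (g₀ : Mat) ∈ bruhatBigCell n R∞
  · refine (ContinuousAt.congr ?_ (cellPush_eventuallyEq_of_mem hg₀).symm)
    exact hc.continuousAt.comp (((cellChartHomeo n R∞).continuousAt_symm hg₀).comp Units.continuous_val.continuousAt)
  · have hg₀' : (g₀ : Mat) ∉ cellChart '' tsupport h := fun h' => hg₀ (image_tsupport_subset hW h')
    exact (continuousAt_const.congr (cellPush_eventuallyEq_zero hh hg₀').symm)

/-- **`cellPush h` has compact support** (`GL_n(K_∞) ↪ M_n(K_∞)` is an open embedding). [folklore] -/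
theorem hasCompactSupport_cellPush {h : E∞ → ℂ} (hh : HasCompactSupport h) (hW : tsupport h ⊆ cellSource n R∞) :
    HasCompactSupport (cellPush (n := n) (K := K) h) := by
  set K' : Set Mat := cellChart '' tsupport h with hK'
  have hK'c : IsCompact K' := isCompact_image_tsupport hh
  have hpre : IsCompact (((↑) : G∞ → Mat) ⁻¹' K') := by
    rw [Units.isOpenEmbedding_val.isInducing.isCompact_iff, image_preimage_eq_inter_range,
      inter_eq_left.2 ((image_tsupport_subset hW).trans bruhatBigCell_subset_range)]
    exact hK'c
  exact HasCompactSupport.intro' hpre (hK'c.isClosed.preimage Units.continuous_val)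
    fun g hg => cellPush_eq_zero_of_not_mem_image hg

/-- The exponential of `M_n(K_∞)` is smooth. [folklore] -/
theorem contDiff_exp_mat : ContDiff ℝ ∞ (NormedSpace.exp : Mat → Mat) :=
  contDiff_iff_contDiffAt.2 fun x => (NormedSpace.exp_analytic x).contDiffAt

/-- **The exponential slices of `cellPush h` are smooth**: `M ↦ cellPush h (g exp M)` is `C^∞` for every `g`.
[folklore] -/
theorem contDiff_cellPush_slice {h : E∞ → ℂ} (hs : ContDiff ℝ ∞ h) (hh : HasCompactSupport h) (hW : tsupport h ⊆ cellSource n R∞)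
    (g : G∞) : ContDiff ℝ ∞ fun M : Mat => cellPush h (g * expGL M) := by
  refine contDiff_iff_contDiffAt.2 fun M₀ => ?_
  have hval : ∀ M : Mat, ((g * expGL M : G∞) : Mat) = (g : Mat) * NormedSpace.exp M := fun M => by
    rw [Units.val_mul, coe_expGL]
  have hsm : ContDiff ℝ ∞ fun M : Mat => (g : Mat) * NormedSpace.exp M := contDiff_const.mul contDiff_exp_mat
  by_cases hM₀ : ((g * expGL M₀ : G∞) : Mat) ∈ bruhatBigCell n R∞
  · -- near `M₀` the slice is `h ∘ Ψ⁻¹ ∘ (M ↦ g exp M)`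
    have hopen : IsOpen {M : Mat | (g : Mat) * NormedSpace.exp M ∈ bruhatBigCell n R∞} :=
      isOpen_bruhatBigCell.preimage hsm.continuous
    have hM₀' : (g : Mat) * NormedSpace.exp M₀ ∈ bruhatBigCell n R∞ := by rwa [hval] at hM₀
    have hev : (fun M : Mat => cellPush h (g * expGL M)) =ᶠ[𝓝 M₀]
        fun M : Mat => h ((cellChartHomeo n R∞).symm ((g : Mat) * NormedSpace.exp M)) := by
      filter_upwards [hopen.mem_nhds hM₀'] with M hM
      rw [cellPush_apply_of_mem (by rwa [hval]), hval]
    refine ContDiffAt.congr_of_eventuallyEq ?_ hev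
    have A : ContDiffAt ℝ ∞ (h ∘ (cellChartHomeo n R∞).symm) ((g : Mat) * NormedSpace.exp M₀) :=
      hs.contDiffAt.comp _ (contDiffAt_cellChartHomeo_symm hM₀')
    have B := ContDiffAt.comp (f := fun M : Mat => (g : Mat) * NormedSpace.exp M) M₀ A hsm.contDiffAt
    simpa only [Function.comp_def] using B
  · -- near `M₀` the slice vanishes
    have hM₀' : ((g * expGL M₀ : G∞) : Mat) ∉ cellChart '' tsupport h := fun h' => hM₀ (image_tsupport_subset hW h')
    have hopen : IsOpen {M : Mat | (g : Mat) * NormedSpace.exp M ∉ cellChart '' tsupport h} :=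
      (isCompact_image_tsupport hh).isClosed.isOpen_compl.preimage hsm.continuous
    have hev : (fun M : Mat => cellPush h (g * expGL M)) =ᶠ[𝓝 M₀] fun _ => 0 := by
      filter_upwards [hopen.mem_nhds (by rwa [hval] at hM₀')] with M hM
      exact cellPush_eq_zero_of_not_mem_image (by rwa [hval])
    exact contDiffAt_const.congr_of_eventuallyEq hev

/-- **`cellPush h` is a test function on `GL_n(K_∞)`** for smooth compactly supported `h` with
`tsupport h ⊆ cellSource`. [folklore] -/
theorem isArchTestFunction_cellPush {h : E∞ → ℂ} (hs : ContDiff ℝ ∞ h) (hh : HasCompactSupport h) (hW : tsupport h ⊆ cellSource n R∞) :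
    IsArchTestFunction n K (cellPush h) :=
  ⟨continuous_cellPush hs.continuous hh hW, hasCompactSupport_cellPush hh hW,
    IsArchTestFunction.isArchSmooth_of_contDiff_slice (contDiff_cellPush_slice hs hh hW)⟩

/-- `tsupport (cellPush h) ⊆ val⁻¹(Ψ(tsupport h))`. [folklore] -/
theorem tsupport_cellPush_subset {h : E∞ → ℂ} (hh : HasCompactSupport h) :
    tsupport (cellPush (n := n) (K := K) h) ⊆ ((↑) : G∞ → Mat) ⁻¹' (cellChart '' tsupport h) := by
  refine closure_minimal (fun g hg => ?_) ((isCompact_image_tsupport hh).isClosed.preimage Units.continuous_val)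
  by_contra hng
  exact hg (cellPush_eq_zero_of_not_mem_image hng)

end TestFunction

/-! ### 3. Left and right translations by `N` in the coordinates of the big cell -/

section Actions

/-- **Left translation by `u ∈ N` in coordinates**: `(X₁, a, X₂) ↦ (u (1 + X₁) - 1, a, X₂)`. [folklore] -/
def leftParamMap (u : ↥(upperUnitriangular (Fin n) R∞)) (e : E∞) : E∞ :=
  (⟨((u : G∞) : Mat) * (1 + (e.1 : Mat)) - 1, by
      have h : (u : G∞) * unitri (e.1 : Mat) e.1.2 ∈ upperUnitriangular (Fin n) R∞ :=
        Subgroup.mul_mem _ u.2 (unitri_mem_upperUnitriangular _ _)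
      have h2 := sub_one_mem_strictUpper h
      exact (mem_strictUpperReal).2 (by simpa only [Units.val_mul, coe_unitri] using h2)⟩,
    e.2.1, e.2.2)

/-- **Right translation by `u ∈ N` in coordinates**: `(X₁, a, X₂) ↦ (X₁, a, (1 + X₂) u - 1)`. [folklore] -/
def rightParamMap (u : ↥(upperUnitriangular (Fin n) R∞)) (e : E∞) : E∞ :=
  (e.1, e.2.1, ⟨(1 + (e.2.2 : Mat)) * ((u : G∞) : Mat) - 1, by
      have h : unitri (e.2.2 : Mat) e.2.2.2 * (u : G∞) ∈ upperUnitriangular (Fin n) R∞ :=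
        Subgroup.mul_mem _ (unitri_mem_upperUnitriangular _ _) u.2
      have h2 := sub_one_mem_strictUpper h
      exact (mem_strictUpperReal).2 (by simpa only [Units.val_mul, coe_unitri] using h2)⟩)

/-- The first coordinate of `leftParamMap u e`. [folklore] -/
@[simp] theorem leftParamMap_fst (u : ↥(upperUnitriangular (Fin n) R∞)) (e : E∞) :
    ((leftParamMap u e).1 : Mat) = ((u : G∞) : Mat) * (1 + (e.1 : Mat)) - 1 := rfl

/-- The torus coordinate is unchanged by `leftParamMap`. [folklore] -/
@[simp] theorem leftParamMap_snd_fst (u : ↥(upperUnitriangular (Fin n) R∞)) (e : E∞) : (leftParamMap u e).2.1 = e.2.1 := rfl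

/-- The third coordinate is unchanged by `leftParamMap`. [folklore] -/
@[simp] theorem leftParamMap_snd_snd (u : ↥(upperUnitriangular (Fin n) R∞)) (e : E∞) : (leftParamMap u e).2.2 = e.2.2 := rfl

/-- The third coordinate of `rightParamMap u e`. [folklore] -/
@[simp] theorem rightParamMap_snd_snd (u : ↥(upperUnitriangular (Fin n) R∞)) (e : E∞) :
    ((rightParamMap u e).2.2 : Mat) = (1 + (e.2.2 : Mat)) * ((u : G∞) : Mat) - 1 := rfl

/-- The torus coordinate is unchanged by `rightParamMap`. [folklore] -/
@[simp] theorem rightParamMap_snd_fst (u : ↥(upperUnitriangular (Fin n) R∞)) (e : E∞) : (rightParamMap u e).2.1 = e.2.1 := rfl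

/-- The first coordinate is unchanged by `rightParamMap`. [folklore] -/
@[simp] theorem rightParamMap_fst (u : ↥(upperUnitriangular (Fin n) R∞)) (e : E∞) : (rightParamMap u e).1 = e.1 := rfl

/-- `leftParamMap` preserves `cellSource`. [folklore] -/
theorem leftParamMap_mem_cellSource (u : ↥(upperUnitriangular (Fin n) R∞)) {e : E∞} (he : e ∈ cellSource n R∞) :
    leftParamMap u e ∈ cellSource n R∞ := he

/-- `rightParamMap` preserves `cellSource`. [folklore] -/
theorem rightParamMap_mem_cellSource (u : ↥(upperUnitriangular (Fin n) R∞)) {e : E∞} (he : e ∈ cellSource n R∞) :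
    rightParamMap u e ∈ cellSource n R∞ := he

/-- **`Ψ(leftParamMap u e) = u Ψ(e)`.** [folklore] -/
theorem cellChart_leftParamMap (u : ↥(upperUnitriangular (Fin n) R∞)) (e : E∞) :
    cellChart (leftParamMap u e) = ((u : G∞) : Mat) * cellChart e := by
  rw [cellChart_apply, cellChart_apply, leftParamMap_fst, leftParamMap_snd_fst, leftParamMap_snd_snd, add_sub_cancel]
  simp only [Matrix.mul_assoc]

/-- **`Ψ(rightParamMap u e) = Ψ(e) u`.** [folklore] -/
theorem cellChart_rightParamMap (u : ↥(upperUnitriangular (Fin n) R∞)) (e : E∞) :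
    cellChart (rightParamMap u e) = cellChart e * ((u : G∞) : Mat) := by
  rw [cellChart_apply, cellChart_apply, rightParamMap_fst, rightParamMap_snd_fst, rightParamMap_snd_snd, add_sub_cancel]
  simp only [Matrix.mul_assoc]

/-- `leftParamMap 1 = id`. [folklore] -/
theorem leftParamMap_one (e : E∞) : leftParamMap (1 : ↥(upperUnitriangular (Fin n) R∞)) e = e := by
  obtain ⟨X₁, a, X₂⟩ := e
  simp only [leftParamMap, OneMemClass.coe_one, Units.val_one, Matrix.one_mul, add_sub_cancel_left]

/-- `leftParamMap (u v) = leftParamMap u ∘ leftParamMap v`. [folklore] -/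
theorem leftParamMap_mul (u v : ↥(upperUnitriangular (Fin n) R∞)) (e : E∞) :
    leftParamMap (u * v) e = leftParamMap u (leftParamMap v e) := by
  obtain ⟨X₁, a, X₂⟩ := e
  simp only [leftParamMap, Subgroup.coe_mul, Units.val_mul, Prod.mk.injEq, and_true]
  apply Subtype.ext
  simp only [add_sub_cancel, Matrix.mul_assoc]

/-- `rightParamMap 1 = id`. [folklore] -/
theorem rightParamMap_one (e : E∞) : rightParamMap (1 : ↥(upperUnitriangular (Fin n) R∞)) e = e := by
  obtain ⟨X₁, a, X₂⟩ := e
  simp only [rightParamMap, OneMemClass.coe_one, Units.val_one, Matrix.mul_one, add_sub_cancel_left]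

/-- `rightParamMap (u v) = rightParamMap v ∘ rightParamMap u`. [folklore] -/
theorem rightParamMap_mul (u v : ↥(upperUnitriangular (Fin n) R∞)) (e : E∞) :
    rightParamMap (u * v) e = rightParamMap v (rightParamMap u e) := by
  obtain ⟨X₁, a, X₂⟩ := e
  simp only [rightParamMap, Subgroup.coe_mul, Units.val_mul, Prod.mk.injEq, true_and]
  apply Subtype.ext
  simp only [add_sub_cancel, Matrix.mul_assoc]

/-- The big cell is stable under left multiplication by `N`, with `Ψ⁻¹(u g) = leftParamMap u (Ψ⁻¹ g)`. [folklore] -/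
theorem symm_mul_left (u : ↥(upperUnitriangular (Fin n) R∞)) {g : Mat} (hg : g ∈ bruhatBigCell n R∞) :
    ((u : G∞) : Mat) * g ∈ bruhatBigCell n R∞ ∧
      (cellChartHomeo n R∞).symm (((u : G∞) : Mat) * g) = leftParamMap u ((cellChartHomeo n R∞).symm g) := by
  set e := (cellChartHomeo n R∞).symm g with he
  have hes : e ∈ cellSource n R∞ := (cellChartHomeo n R∞).map_target hg
  have hge : g = cellChart e := by rw [he, ← cellChartHomeo_apply, (cellChartHomeo n R∞).right_inv hg]
  have h1 : ((u : G∞) : Mat) * g = cellChart (leftParamMap u e) := by rw [cellChart_leftParamMap, hge]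
  refine ⟨?_, ?_⟩
  · rw [h1]; exact (cellChartHomeo n R∞).map_source (leftParamMap_mem_cellSource u hes)
  · rw [h1, ← cellChartHomeo_apply, (cellChartHomeo n R∞).left_inv (leftParamMap_mem_cellSource u hes)]

/-- The big cell is stable under right multiplication by `N`, with `Ψ⁻¹(g u) = rightParamMap u (Ψ⁻¹ g)`. [folklore] -/
theorem symm_mul_right (u : ↥(upperUnitriangular (Fin n) R∞)) {g : Mat} (hg : g ∈ bruhatBigCell n R∞) :
    g * ((u : G∞) : Mat) ∈ bruhatBigCell n R∞ ∧
      (cellChartHomeo n R∞).symm (g * ((u : G∞) : Mat)) = rightParamMap u ((cellChartHomeo n R∞).symm g) := by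
  set e := (cellChartHomeo n R∞).symm g with he
  have hes : e ∈ cellSource n R∞ := (cellChartHomeo n R∞).map_target hg
  have hge : g = cellChart e := by rw [he, ← cellChartHomeo_apply, (cellChartHomeo n R∞).right_inv hg]
  have h1 : g * ((u : G∞) : Mat) = cellChart (rightParamMap u e) := by rw [cellChart_rightParamMap, hge]
  refine ⟨?_, ?_⟩
  · rw [h1]; exact (cellChartHomeo n R∞).map_source (rightParamMap_mem_cellSource u hes)
  · rw [h1, ← cellChartHomeo_apply, (cellChartHomeo n R∞).left_inv (rightParamMap_mem_cellSource u hes)]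

/-- **Left multiplication by `u ∈ N` on `cellPush`**: `cellPush h (u x) = cellPush (h ∘ leftParamMap u) x`. [folklore] -/
theorem cellPush_mul_left (u : ↥(upperUnitriangular (Fin n) R∞)) (h : E∞ → ℂ) (x : G∞) :
    cellPush h ((u : G∞) * x) = cellPush (h ∘ leftParamMap u) x := by
  by_cases hx : (x : Mat) ∈ bruhatBigCell n R∞
  · obtain ⟨hmem, hsymm⟩ := symm_mul_left u hx
    rw [cellPush_apply_of_mem hx, cellPush_apply_of_mem (by rw [Units.val_mul]; exact hmem), Function.comp_apply,
      ← hsymm, Units.val_mul]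
  · have hux : (((u : G∞) * x : G∞) : Mat) ∉ bruhatBigCell n R∞ := by
      intro hmem
      apply hx
      have h1 := (symm_mul_left u⁻¹ hmem).1
      rwa [← Units.val_mul, Subgroup.coe_inv, inv_mul_cancel_left] at h1
    rw [cellPush_apply_of_not_mem hux, cellPush_apply_of_not_mem hx]


/-- **Right multiplication by `u ∈ N` on `cellPush`**: `cellPush h (x u) = cellPush (h ∘ rightParamMap u) x`. [folklore] -/
theorem cellPush_mul_right (u : ↥(upperUnitriangular (Fin n) R∞)) (h : E∞ → ℂ) (x : G∞) :
    cellPush h (x * (u : G∞)) = cellPush (h ∘ rightParamMap u) x := by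
  by_cases hx : (x : Mat) ∈ bruhatBigCell n R∞
  · obtain ⟨hmem, hsymm⟩ := symm_mul_right u hx
    rw [cellPush_apply_of_mem hx, cellPush_apply_of_mem (by rw [Units.val_mul]; exact hmem), Function.comp_apply,
      ← hsymm, Units.val_mul]
  · have hux : ((x * (u : G∞) : G∞) : Mat) ∉ bruhatBigCell n R∞ := by
      intro hmem
      apply hx
      have h1 := (symm_mul_right u⁻¹ hmem).1
      rwa [← Units.val_mul, Subgroup.coe_inv, mul_inv_cancel_right] at h1
    rw [cellPush_apply_of_not_mem hux, cellPush_apply_of_not_mem hx]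

/-- The root element `1 + t E` of `N` for a strictly upper `E`. [folklore] -/
def rootElement (E : Mat) (hE : E ∈ strictUpper n R∞) (t : ℝ) : ↥(upperUnitriangular (Fin n) R∞) :=
  ⟨unitri (t • E) ((strictUpperReal n R∞).smul_mem t hE), unitri_mem_upperUnitriangular _ _⟩

/-- The matrix of `rootElement E t` is `1 + t E`. [folklore] -/
@[simp] theorem coe_rootElement (E : Mat) (hE : E ∈ strictUpper n R∞) (t : ℝ) :
    (((rootElement E hE t : ↥(upperUnitriangular (Fin n) R∞)) : G∞) : Mat) = 1 + t • E := rfl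

/-- The basis-type vector `(E, 0, 0)` of the parameter space. [folklore] -/
def leftRootVector (E : Mat) (hE : E ∈ strictUpper n R∞) : E∞ := (⟨E, hE⟩, 0, 0)

/-- The basis-type vector `(0, 0, E)` of the parameter space. [folklore] -/
def rightRootVector (E : Mat) (hE : E ∈ strictUpper n R∞) : E∞ := (0, 0, ⟨E, hE⟩)

/-- **Root elements on the left act by translations of the first coordinate**: if `E` is strictly upper with
`E X = 0` for all strictly upper `X` (e.g. `E` supported in the last column), then
`leftParamMap (1 + t E) (X₁, a, X₂) = (X₁ + t E, a, X₂)`. [folklore] -/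
theorem leftParamMap_rootElement {E : Mat} (hE : E ∈ strictUpper n R∞) (hE0 : ∀ X : Mat, X ∈ strictUpper n R∞ → E * X = 0)
    (t : ℝ) (e : E∞) : leftParamMap (rootElement E hE t) e = e + t • leftRootVector E hE := by
  obtain ⟨⟨X₁, hX₁⟩, a, X₂⟩ := e
  refine Prod.ext (Subtype.ext ?_) (Prod.ext ?_ ?_)
  · simp only [leftParamMap_fst, coe_rootElement, leftRootVector, Prod.fst_add, Prod.smul_fst, Submodule.coe_add,
      Submodule.coe_smul]
    rw [add_mul, Matrix.one_mul, Matrix.mul_add, Matrix.mul_one, smul_mul_assoc, hE0 X₁ hX₁, smul_zero, add_zero]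
    abel
  · simp [leftRootVector]
  · simp [leftRootVector]

/-- **Root elements on the right act by translations of the third coordinate**: if `E` is strictly upper with
`X E = 0` for all strictly upper `X` (e.g. `E` supported in the first row), then
`rightParamMap (1 + t E) (X₁, a, X₂) = (X₁, a, X₂ + t E)`. [folklore] -/
theorem rightParamMap_rootElement {E : Mat} (hE : E ∈ strictUpper n R∞) (hE0 : ∀ X : Mat, X ∈ strictUpper n R∞ → X * E = 0)
    (t : ℝ) (e : E∞) : rightParamMap (rootElement E hE t) e = e + t • rightRootVector E hE := by
  obtain ⟨X₁, a, ⟨X₂, hX₂⟩⟩ := e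
  refine Prod.ext ?_ (Prod.ext ?_ (Subtype.ext ?_))
  · simp [rightRootVector]
  · simp [rightRootVector]
  · simp only [rightParamMap_snd_snd, coe_rootElement, rightRootVector, Prod.snd_add, Prod.smul_snd, Submodule.coe_add,
      Submodule.coe_smul]
    rw [mul_add, Matrix.mul_one, Matrix.add_mul, Matrix.one_mul, mul_smul_comm, hE0 X₂ hX₂, smul_zero, add_zero]
    abel

/-- `(1 + t E)⁻¹ = 1 - t E` for `E` with `E 𝔫 = 0` (so `E² = 0`): `rootElement E t⁻¹ = rootElement E (-t)`. [folklore] -/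
theorem rootElement_inv {E : Mat} (hE : E ∈ strictUpper n R∞) (hEE : E * E = 0) (t : ℝ) :
    (rootElement E hE t)⁻¹ = rootElement E hE (-t) := by
  rw [inv_eq_iff_mul_eq_one]
  apply Subtype.ext
  apply Units.ext
  simp only [Subgroup.coe_mul, Units.val_mul, coe_rootElement, OneMemClass.coe_one, Units.val_one]
  rw [add_mul, Matrix.one_mul, Matrix.mul_add, Matrix.mul_one, smul_mul_smul_comm, hEE, smul_zero, add_zero, neg_smul]
  abel

/-- **Left translation by a last-column root element is a translation of the parameter**:
`cellPush h ((1 + tE)⁻¹ x) = cellPush (translate_{t (E,0,0)} h)(x)` in the convention `τ_u h (e) = h (e - u)`.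
[folklore] -/
theorem cellPush_rootElement_inv_mul {E : Mat} (hE : E ∈ strictUpper n R∞)
    (hE0 : ∀ X : Mat, X ∈ strictUpper n R∞ → E * X = 0) (t : ℝ) (h : E∞ → ℂ) (x : G∞) :
    cellPush h ((((rootElement E hE t)⁻¹ : ↥(upperUnitriangular (Fin n) R∞)) : G∞) * x) =
      cellPush (fun e => h (e - t • leftRootVector E hE)) x := by
  rw [rootElement_inv hE (hE0 E hE), cellPush_mul_left]
  congr 1
  funext e
  simp only [Function.comp_apply, leftParamMap_rootElement hE hE0, sub_eq_add_neg]
  congr 2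
  exact neg_smul t (leftRootVector E hE)

/-- **Right translation by a first-row root element is a translation of the parameter**:
`cellPush h (x (1 + tE)) = cellPush (e ↦ h (e + t (0,0,E)))(x)`. [folklore] -/
theorem cellPush_mul_rootElement {E : Mat} (hE : E ∈ strictUpper n R∞)
    (hE0 : ∀ X : Mat, X ∈ strictUpper n R∞ → X * E = 0) (t : ℝ) (h : E∞ → ℂ) (x : G∞) :
    cellPush h (x * ((rootElement E hE t : ↥(upperUnitriangular (Fin n) R∞)) : G∞)) =
      cellPush (fun e => h (e + t • rightRootVector E hE)) x := by
  rw [cellPush_mul_right]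
  congr 1
  funext e
  rw [Function.comp_apply, rightParamMap_rootElement hE hE0]

end Actions

end Literature.NumberTheory.Automorphic
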